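import Literature.RepresentationTheory.FiniteGroups.SymmetricGroupFrobeniusFormula
import Literature.RepresentationTheory.FiniteGroups.SymmetricGroupCyclePeeling
import Literature.Computability.Complexity.OccurrenceObstructionsIPSquareProofs
import Literature.Computability.Complexity.OccurrenceObstructionsIPHookPositivity
import HarnessLib

/-!
# The two Murnaghan–Nakayama values for square shapes, and `g(a × a, a × a, a × a) > 0`
# unconditionally (discharge of `ikenmeyerPanova2017_square_pos`)

Sibling proofs file (D-0014) of `Literature/Computability/Complexity/OccurrenceObstructionsIP.lean`.
The named fact `ikenmeyerPanova2017_square_pos` there — Ikenmeyer–Panova, Adv. Math. 319 (2017),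
§1.1, quoting C. Bessenrodt, C. Behns, *On the Durfee size of Kronecker products of characters of
the symmetric group and its double covers*, J. Algebra 280 (2004), Thm. 3.1 / Cor. 3.2 and the
Remark on p. 136 ("a positive answer to Vallejo's question whether `[a^a] ∈ [a^a]²`"):
`g(a × a, a × a, a × a) > 0` for all `a ≥ 1` — was reduced in
`OccurrenceObstructionsIPSquareProofs.lean` (`ikenmeyerPanova2017_square_pos_of_spechtCharacter_values`,
Bessenrodt–Behns' alternating-group argument through a twisted-trace criterion) to two character
values of `χ^{a×a}` given by the Murnaghan–Nakayama rule (James–Kerber 2.4.8, 2.4.9):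

* `h1`: `χ^{a×a}(g) = ±1` for `g` of cycle type `h(a×a) = (2a-1, 2a-3, …, 3, 1)`;
* `h2`: `χ^{a×a}(g) = 0` if `g` has a cycle of length `≥ 2a`.

This file PROVES both (`murnaghanNakayama_square_h1`, `murnaghanNakayama_square_h2`) from
**Frobenius's character formula** (`spechtCharacter_eq_frobeniusChar`,
`Literature/RepresentationTheory/FiniteGroups/SymmetricGroupFrobeniusFormula.lean`) and the
cycle-peeling identities of `SymmetricGroupCyclePeeling.lean`, and concludes the unconditional

* `ikenmeyerPanova2017_square_pos_holds : ikenmeyerPanova2017_square_pos`.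

## Proofs

With `N = a` variables, `λ = a × a` has `λ + ρ = α = (2a-1, 2a-2, …, a)`. Write `g = cτ` with `c`
an `m`-cycle disjoint from `τ` (`Equiv.Perm.mem_cycleType_iff`); then `F_g = p_m F_{τ|B}`
(`fixedWordPoly_cycle_mul`) and `χ^{a×a}(g) = [x^α](p_m · G)`, `G = a_ρ F_{τ|B}`,
`= ∑_{i : α_i ≥ m} [x^{α - m e_i}] G` (`coeff_psum_mul`).
* `h2` (`spechtCharacter_square_eq_zero_of_le_cycle`): `α_i ≤ 2a - 1 < m`, the sum is empty.
* `h1` (`spechtCharacter_square_hookClass`, induction on `a`, peeling the `(2a+1)`-cycle of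
  `g ∈ 𝔖_{(a+1)²}`): only `i = 0` contributes; `α - (2a+1)e_0 = (0, 2a, …, a+1)` is the rotation
  `finRotate (a+1)` (sign `(-1)^a`) of `(2a, …, a+1, 0) = μ + ρ`, `μ = (a^a, 0)` the square
  `a × a` padded to `a + 1` parts; by antisymmetry (`coeff_mapDomain_of_rename_eq`) and Frobenius's
  formula for `a × a` in `a + 1` variables, `χ^{(a+1)²}(g) = (-1)^a χ^{a×a}(τ')` with `τ'` the
  transport of `τ|B` to `𝔖_{a²}`, of cycle type `(2a-1, …, 3)` (`cycleType_subtypePerm_of_disjoint`,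
  `cycleType_permCongr`). Base `a = 1`: `χ^{(1)}(1)² = 1! ` (`sum_spechtCharacter_mul_self`).
  (This is the unique-rim-hook recursion `χ^{a×a}(h(a×a)) = (-1)^{a-1} χ^{(a-1)²}(h((a-1)²))`
  of James–Kerber 2.4.7/2.4.8.)

## References

* C. Bessenrodt, C. Behns, J. Algebra 280 (2004) 132–144, Thm. 3.1, Cor. 3.2, Remark p. 136.
  [BessenrodtBehns2004]
* C. Ikenmeyer, G. Panova, Adv. Math. 319 (2017) 40–66, §1.1. [IkenmeyerPanova2017]
* G. James, A. Kerber, *The Representation Theory of the Symmetric Group* (1981), 2.3.15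
  (Frobenius's formula), 2.4.7–2.4.9 (Murnaghan–Nakayama). [JamesKerber1981]
* W. Fulton, J. Harris, *Representation Theory*, GTM 129, Thm. 4.10, Ex. 4.45. [FultonHarrisGTM129]
-/

noncomputable section

open scoped BigOperators
open MvPolynomial Finset

namespace Literature.Computability.Complexity

open Literature.RepresentationTheory.FiniteGroups
open Literature.RingTheory.SymmetricFunctions.SymmPoly (alternant rho rho_apply)
open Literature.NumberTheory.DiophantineGeometry (spechtCharacter)

section SquareValues

/-- The square `a × a` has `a` parts (for `a ≠ 0`). [folklore] -/
theorem card_parts_rectangle_self {a : ℕ} (ha : a ≠ 0) :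
    (Nat.Partition.rectangle a a).parts.card = a := by
  rw [← Nat.Partition.length_sortedParts, sortedParts_rectangle a a ha, List.length_replicate]

/-- The exponent vector `λ + ρ` of the square `a × a` in `N` variables: entry `i` is
`(if i < a then a else 0) + (N - 1 - i)`. [folklore] -/
theorem square_add_rho_apply (a N : ℕ) (i : Fin N) :
    ((fun i : Fin N => (Nat.Partition.rectangle a a).sortedParts.getD i 0) + rho N) i =
      (if (i : ℕ) < a then a else 0) + (N - (i + 1)) := by
  simp only [Pi.add_apply, getD_sortedParts_rectangle, rho_apply]

/-- **James–Kerber 2.4.9 for squares (`h2`)**: if `g ∈ 𝔖_{a²}` has a cycle of length `≥ 2a`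
(longer than the largest hook `2a - 1` of `a × a`), then `χ^{a×a}(g) = 0`. Proof: by Frobenius's
formula in `a` variables `χ^{a×a}(g) = [x^α](a_ρ F_g)` with `α = (2a-1, 2a-2, …, a)`; peeling the
long cycle, `F_g = p_m F'` and `[x^α](p_m G) = ∑_{i : α_i ≥ m} … ` is an empty sum as `α_i < 2a ≤ m`.
[cite: JamesKerber1981, 2.4.9 with 2.3.15] -/
theorem spechtCharacter_square_eq_zero_of_le_cycle {a : ℕ} (g : Equiv.Perm (Fin (a * a)))
    (h : ∃ m ∈ g.cycleType, 2 * a ≤ m) :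
    spechtCharacter ℂ (Nat.Partition.rectangle a a) g = 0 := by
  classical
  obtain ⟨m, hm, hle⟩ := h
  obtain ⟨c, τ, rfl, hd, hc, hcard⟩ := Equiv.Perm.mem_cycleType_iff.1 hm
  have ha : a ≠ 0 := by
    rintro rfl
    have h2 := Equiv.Perm.two_le_of_mem_cycleType hm
    have := Equiv.Perm.le_card_support_of_mem_cycleType hm
    have hs : (c * τ).support.card ≤ Fintype.card (Fin (0 * 0)) := Finset.card_le_univ _
    rw [Fintype.card_fin] at hs
    omega
  rw [spechtCharacter_eq_frobeniusChar (N := a) _ (by rw [card_parts_rectangle_self ha]),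
    frobeniusChar_def, fixedWordPoly_cycle_mul hd hc, hcard, mul_left_comm, coeff_psum_mul]
  rw [Finset.filter_eq_empty_iff.2, Finset.sum_empty, Int.cast_zero]
  intro i _
  rw [Finsupp.coe_equivFunOnFinite_symm, square_add_rho_apply, if_pos i.2]
  have := i.2
  omega

/-- The base case `a = 1`: `χ^{(1)}(1) = ±1` (indeed `1`; from `∑_σ χ(σ)² = 1! = 1`).
[folklore] -/
theorem spechtCharacter_square_one (g : Equiv.Perm (Fin (1 * 1))) :
    spechtCharacter ℂ (Nat.Partition.rectangle 1 1) g = 1 ∨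
      spechtCharacter ℂ (Nat.Partition.rectangle 1 1) g = -1 := by
  haveI : Subsingleton (Fin (1 * 1)) := by rw [Nat.mul_one]; infer_instance
  haveI : Subsingleton (Equiv.Perm (Fin (1 * 1))) := inferInstance
  have h := sum_spechtCharacter_mul_self (Nat.Partition.rectangle 1 1)
  have h1 : (((1 * 1).factorial : ℕ) : ℂ) = 1 := by norm_num
  rw [Fintype.sum_subsingleton _ g, h1] at h
  have h' : (spechtCharacter ℂ (Nat.Partition.rectangle 1 1) g - 1) *
      (spechtCharacter ℂ (Nat.Partition.rectangle 1 1) g + 1) = 0 := by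
    rw [← sub_eq_zero] at h
    rw [← h]
    ring
  rcases mul_eq_zero.1 h' with h1 | h1
  · exact Or.inl (sub_eq_zero.1 h1)
  · exact Or.inr (eq_neg_of_add_eq_zero_left h1)

/-- **James–Kerber 2.4.8 for squares (`h1`)**: for `a ≥ 1` and `g ∈ 𝔖_{a²}` of cycle type
`h(a × a) = (2a-1, 2a-3, …, 3, 1)` (the principal hook lengths; Mathlib's `cycleType` omits the
fixed point), `χ^{a×a}(g) = ±1` (indeed `(-1)^{a(a-1)/2}`). Proof by induction on `a`: peel the
`(2a-1)`-cycle `c`, `g = cτ`; by Frobenius's formula in `a` variables and `F_g = p_{2a-1} F_{τ|B}`,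
`χ^{a×a}(g) = [x^{(2a-1,…,a)}](p_{2a-1} G) = [x^{(0,2a-2,…,a)}] G` with `G = a_ρ F_{τ|B}`
antisymmetric, `= sign(rotation) · [x^{(2a-2,…,a,0)}] G = (-1)^{a-1} χ^{(a-1)×(a-1)}(τ|B)` by
Frobenius's formula for `(a-1) × (a-1)` in `a` variables (this is the unique rim hook of the
Murnaghan–Nakayama recursion). [cite: JamesKerber1981, 2.4.8 with 2.4.7 and 2.3.15] -/
theorem spechtCharacter_square_hookClass {a : ℕ} (ha : 0 < a) (g : Equiv.Perm (Fin (a * a)))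
    (hg : g.cycleType = (Multiset.range (a - 1)).map (fun i => 2 * i + 3)) :
    spechtCharacter ℂ (Nat.Partition.rectangle a a) g = 1 ∨
      spechtCharacter ℂ (Nat.Partition.rectangle a a) g = -1 := by
  classical
  induction a, Nat.one_le_iff_ne_zero.2 ha.ne' using Nat.le_induction with
  | base => exact spechtCharacter_square_one g
  | succ a ha1 ih =>
    -- peel the `(2a+1)`-cycle
    have hmem : 2 * a + 1 ∈ g.cycleType := by
      rw [hg, Multiset.mem_map]
      exact ⟨a - 1, Multiset.mem_range.2 (by omega), by omega⟩
    obtain ⟨c, τ, rfl, hd, hc, hcard⟩ := Equiv.Perm.mem_cycleType_iff.1 hmem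
    -- the cycle type of `τ`
    have hτ : τ.cycleType = (Multiset.range (a - 1)).map (fun i => 2 * i + 3) := by
      have h1 := hd.cycleType_mul
      rw [hc.cycleType, hcard, hg, Multiset.singleton_add, show a + 1 - 1 = (a - 1) + 1 by omega,
        Multiset.range_succ, Multiset.map_cons, show 2 * (a - 1) + 3 = 2 * a + 1 by omega] at h1
      exact (Multiset.cons_inj_right _).1 h1.symm
    -- the restriction of `τ` to `B = (supp c)ᶜ`, transported to `Fin (a * a)`
    set τB := τ.subtypePerm (p := fun x => x ∈ c.supportᶜ)
      (fun x => mem_compl_support_iff_of_disjoint hd x) with hτB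
    have hcardB : Fintype.card ↥(c.supportᶜ) = Fintype.card (Fin (a * a)) := by
      rw [Fintype.card_coe, Finset.card_compl, hcard, Fintype.card_fin, Fintype.card_fin]
      simp only [Nat.add_mul, Nat.mul_add]  -- (a+1)(a+1) - (2a+1) = a a
      omega
    set eB : ↥(c.supportᶜ) ≃ Fin (a * a) := Fintype.equivOfCardEq hcardB with heB
    set τ' : Equiv.Perm (Fin (a * a)) := eB.permCongr τB with hτ'
    have hτ'type : τ'.cycleType = (Multiset.range (a - 1)).map (fun i => 2 * i + 3) := by
      rw [hτ', cycleType_permCongr, hτB, cycleType_subtypePerm_of_disjoint hd, hτ]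
    have ih' := ih (by omega) τ' hτ'type
    -- the two exponent vectors and the rotation relating them
    set lamV : Fin (a + 1) → ℕ := fun i => (Nat.Partition.rectangle (a + 1) (a + 1)).sortedParts.getD i 0
      with hlamV
    set μV : Fin (a + 1) → ℕ := fun i => (Nat.Partition.rectangle a a).sortedParts.getD i 0 with hμV
    set α : Fin (a + 1) →₀ ℕ := Finsupp.equivFunOnFinite.symm (lamV + rho (a + 1)) with hα
    set γ : Fin (a + 1) →₀ ℕ := Finsupp.equivFunOnFinite.symm (μV + rho (a + 1)) with hγ
    set e : Equiv.Perm (Fin (a + 1)) := finRotate (a + 1) with he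
    have hαapply : ∀ i : Fin (a + 1), α i = 2 * a + 1 - i := by
      intro i
      rw [hα, Finsupp.coe_equivFunOnFinite_symm, hlamV, square_add_rho_apply]
      have := i.2
      rw [if_pos this]
      omega
    have hγapply : ∀ i : Fin (a + 1), γ i = if (i : ℕ) < a then 2 * a - i else 0 := by
      intro i
      rw [hγ, Finsupp.coe_equivFunOnFinite_symm, hμV, square_add_rho_apply]
      have := i.2
      split_ifs <;> omega
    have hrot : α - Finsupp.single 0 (2 * a + 1) = Finsupp.mapDomain e γ := by
      ext j
      rw [Finsupp.mapDomain_equiv_apply]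
      obtain ⟨i, rfl⟩ := e.surjective j
      rw [Equiv.symm_apply_apply, Finsupp.coe_tsub, Pi.sub_apply, hαapply, hγapply,
        Finsupp.single_apply]
      rw [he, finRotate_apply, Fin.val_add_one]
      have hi := i.2
      by_cases hlast : i = Fin.last a
      · subst hlast
        simp
      · rw [if_neg hlast, if_neg, if_pos]
        · omega
        · rw [Fin.ext_iff] at hlast
          rw [Fin.val_last] at hlast
          omega
        · intro h0
          rw [Fin.ext_iff, Fin.val_zero, Fin.val_add_one, if_neg hlast] at h0
          omega
    -- the integer identity `X^{(a+1)×(a+1)}(cτ) = sign(e) · X^{a×a}(τ|B)`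
    have key : frobeniusChar (a + 1) lamV (c * τ) =
        (Equiv.Perm.sign e : ℤ) * frobeniusChar (a + 1) μV τB := by
      rw [frobeniusChar_def, fixedWordPoly_cycle_mul hd hc, hcard, mul_left_comm, coeff_psum_mul,
        ← hα]
      have hfilter : (univ.filter fun i : Fin (a + 1) => 2 * a + 1 ≤ α i) = {0} := by
        ext i
        simp only [mem_filter, mem_univ, true_and, Finset.mem_singleton, hαapply, Fin.ext_iff,
          Fin.val_zero]
        omega
      rw [hfilter, Finset.sum_singleton, hrot,
        coeff_mapDomain_of_rename_eq (rename_alternant_mul_fixedWordPoly _ _ e), frobeniusChar_def]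
    -- back to characters
    have hN1 : (Nat.Partition.rectangle (a + 1) (a + 1)).parts.card ≤ a + 1 := by
      rw [card_parts_rectangle_self (by omega)]
    have hN2 : (Nat.Partition.rectangle a a).parts.card ≤ a + 1 := by
      rw [card_parts_rectangle_self (by omega)]
      omega
    rw [spechtCharacter_eq_frobeniusChar (N := a + 1) _ hN1, key, ← frobeniusChar_permCongr μV eB τB,
      Int.cast_mul, ← spechtCharacter_eq_frobeniusChar (N := a + 1) _ hN2 τ']
    rcases Int.units_eq_one_or (Equiv.Perm.sign e) with hs | hs <;> rcases ih' with h | h <;>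
      simp [hs, h]

/-- **`χ^{a×a}` at the class of principal hooks is `±1`** in the form consumed by
`ikenmeyerPanova2017_square_pos_of_spechtCharacter_values` (hypothesis `h1`).
[cite: JamesKerber1981, 2.4.8] -/
theorem murnaghanNakayama_square_h1 : ∀ (a : ℕ) (g : Equiv.Perm (Fin (a * a))), 0 < a →
    g.cycleType = (Multiset.range (a - 1)).map (fun i => 2 * i + 3) →
    spechtCharacter ℂ (Nat.Partition.rectangle a a) g = 1 ∨
      spechtCharacter ℂ (Nat.Partition.rectangle a a) g = -1 :=
  fun _ g ha hg => spechtCharacter_square_hookClass ha g hg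

/-- **`χ^{a×a}` vanishes at permutations with a cycle of length `≥ 2a`** in the form consumed by
`ikenmeyerPanova2017_square_pos_of_spechtCharacter_values` (hypothesis `h2`).
[cite: JamesKerber1981, 2.4.9] -/
theorem murnaghanNakayama_square_h2 : ∀ (a : ℕ) (g : Equiv.Perm (Fin (a * a))),
    (∃ c ∈ g.cycleType, 2 * a ≤ c) → spechtCharacter ℂ (Nat.Partition.rectangle a a) g = 0 :=
  fun _ g h => spechtCharacter_square_eq_zero_of_le_cycle g h

end SquareValues

/-! ### The discharge -/

/-- **Discharge of the named fact `ikenmeyerPanova2017_square_pos`** (Bessenrodt–Behns 2004,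
Thm. 3.1 / Cor. 3.2 and the Remark on p. 136, quoted by Ikenmeyer–Panova, Adv. Math. 319 (2017),
§1.1): `g(a × a, a × a, a × a) > 0` for every `a ≥ 1`. Unconditional: the reduction
`ikenmeyerPanova2017_square_pos_of_spechtCharacter_values` (`OccurrenceObstructionsIPSquareProofs.lean`,
Bessenrodt–Behns' `A_n`-argument through the twisted-trace criterion) fed with the two
Murnaghan–Nakayama values `murnaghanNakayama_square_h1/h2`, themselves consequences of
Frobenius's character formula (`SymmetricGroupFrobeniusFormula.lean`).
[cite: BessenrodtBehns2004, Thm. 3.1 and Cor. 3.2] -/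
theorem ikenmeyerPanova2017_square_pos_holds : ikenmeyerPanova2017_square_pos :=
  ikenmeyerPanova2017_square_pos_of_spechtCharacter_values murnaghanNakayama_square_h1
    murnaghanNakayama_square_h2

end Literature.Computability.Complexity

end
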